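import Mathlib

/-!
# Hub law — the signed octagon bound and the LINE-10 rank-5 witness (cell pub-hsemireg · 18881 · embed g11)

Companion kernel file of the memo `HUB-LAW-embed-g11.md` (same directory).
HONESTY CLAUSE: nothing here is proved toward HC ∕ HC_CM ∕ HC_AV ∕ №4 ∕ 26512 ∕ 18881 ∕ H2, and nothing is a rung of
`stub_rung_pad4_seedAt`; this is EVIDENCE (pure linear algebra over `ℂ`), Mathlib-only, no `sorry`, no new axioms.

## What is certified (pure algebra; the sheaf-level reading — tight sets, strict Hall, avoidance — is PEN, in the memo)

The model is the one of `TwoTermBlockLaw.lean` (embed g10, same directory; its §«model» and the pairing identity are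
reproduced VERBATIM in Part 0 so that this file is self-contained): a `2^F × 2^F` matrix in the product basis of
`(ℂ²)^{⊗F}` is indexed by `st : Fin F → Bool × Bool`; `momentTensor w v = Σ_j w_j ⊗_f |v_{j f}⟩⟨v_{j f}|`;
`weilTarget F μ = μ |0…0⟩⟨1…1| + conj μ |1…1⟩⟨0…0|`; `CleanWithCharge w v μ : momentTensor w v = weilTarget F μ`.

* `weilCharge_eq_zero_of_few_positive` (SIGNED OCTAGON BOUND, `F = 4`, pole-free): if the weighted product projectors are
  clean with charge `μ`, every vector is NON-POLAR (both coordinates `≠ 0`) and AT MOST THREE TERMS HAVE POSITIVE WEIGHT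
  (any number of non-positive terms, any vectors), then `μ = 0`.  This is the algebraic half of the HUB LAW of the memo
  (§3): in a torsion-free one-apex two-term UP room of rank `r ≤ 4` with hub letters, after cancelling the iso blocks the
  positive order-4 terms are carried by at most `r − 1 ≤ 3` residual hub-free cells, so the Weil charge vanishes —
  in EVERY CM frame, at EVERY height (the memo's §3 gives the pen proof with poles as well).
  Ingredients: `qform_kmat` (the PSD annihilator `|v^⊥⟩⟨v^⊥|` of a vector, off-diagonal entry `−v₁ conj v₀ ≠ 0` iff `v`
  non-polar), `qform_gmat` (the PSD phase probe `[[1, conj ζ],[ζ, 1]]`, `|ζ| = 1`), `re_nonpos_of_psd_kill` (pairing with a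
  PSD family that kills the positive terms gives `Re(μ Z) ≤ 0`), and the four phases `ζ ∈ {1, i, −1, −i}`.
* `lineTen_sharp`, `lineTen_charge_ne_zero` (RANK-5 WITNESS ON THE RECORD FRAME, LINE 10): on the equator `|β| = 5` of the
  `ℚ(i)` frame, the design «`+1` on the Pythagorean `μ₄`-orbit `(3+4i)·i^m`, `−1` on the unit orbit `5·i^m`», taken
  diagonally, is clean with charge `μ₁₀ = (−4608 + 1344 i)/625 ≠ 0`; with five hub letters added on the positive side this
  is the order-`≤ 4` moment certificate `(D1)–(D4)` (κ = 0) of the rank-5 room of memo §4 (all eight rays have `|z| = 1`,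
  `lineTen_on_equator`; the unit letters `(5, 5ū)` are 5-divisible, which is what makes the room torsion-free — pen, memo §4).
* (pen, memo §5 — the TWO-ORBIT MECHANISM behind the witness: for two `μ₄`-orbits `{i^m z₀}`, `{i^m z₁}` on one circle with
  weights `±1` every power sum `Σ w z^a conj z^b`, `a, b ≤ 4`, vanishes except the Weil modes `(4,0), (0,4)`, equal to
  `4(z₀⁴ − z₁⁴)` and its conjugate — the Weil mode is the `μ₄`-INVARIANT one; `tenS_eq` is its instance `z₀ = (3+4i)/5`, `z₁ = 1`.)

Sources: cell memos TWO-TERM-BLOCK-LAW-embed-g10 (model, pairing identity, octagon bound), OCTAGON-ONSET-THEOREM-embed-g9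
(cocircularity, forced octagon weights), CELESTIAL-PHASE-LAW-embed-g6 ((M′)(T′)(ω)), PhaseTorusLaw.lean (record (M)(T)(P),
DOWN law); Buchsbaum–Eisenbud / Auslander–Buchsbaum (torsion of a pd-1 cokernel lives on the divisor of the maximal minors);
Bănică 1991 ∕ Ottaviani (Bertini-type theorem for degeneracy loci of generic maps between globally generated bundles).
-/

set_option linter.dupNamespace false

open scoped BigOperators ComplexConjugate

namespace Summit.HodgeConjecture.HodgeConjecture.Cruxes.BlochSeedDiscOne.HubLaw

open Complex Finset

/-! ## Part 0 — the model and the pairing identity (verbatim from `TwoTermBlockLaw.lean`, embed g10) -/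

/-- Index of an entry of a `2^F × 2^F` matrix in the product basis: per factor (row bit, column bit). -/
abbrev Idx (F : ℕ) := Fin F → Bool × Bool

/-- Coordinate `b` of a vector `p = (p₀, p₁) ∈ ℂ²`. -/
def comp (p : ℂ × ℂ) (b : Bool) : ℂ := bif b then p.2 else p.1

@[simp] theorem comp_false (p : ℂ × ℂ) : comp p false = p.1 := rfl
@[simp] theorem comp_true (p : ℂ × ℂ) : comp p true = p.2 := rfl

/-- Entry `st` of the product projector `⊗_f |v_f⟩⟨v_f|`. -/
def projEntry {F : ℕ} (v : Fin F → ℂ × ℂ) (st : Idx F) : ℂ :=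
  ∏ f, comp (v f) (st f).1 * conj (comp (v f) (st f).2)

/-- The order-`F` moment tensor `Σ_j w_j ⊗_f |v_{j f}⟩⟨v_{j f}|`. -/
def momentTensor {F : ℕ} {ι : Type*} [Fintype ι] (w : ι → ℝ) (v : ι → Fin F → ℂ × ℂ) (st : Idx F) : ℂ :=
  ∑ j, (w j : ℂ) * projEntry (v j) st

/-- The Weil target `μ |0…0⟩⟨1…1| + conj μ |1…1⟩⟨0…0|`. -/
def weilTarget (F : ℕ) (μ : ℂ) (st : Idx F) : ℂ :=
  (if st = (fun _ => (false, true)) then μ else 0) + (if st = (fun _ => (true, false)) then conj μ else 0)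

/-- Order-`F` cleanness with Weil charge `μ`. -/
def CleanWithCharge {F : ℕ} {ι : Type*} [Fintype ι] (w : ι → ℝ) (v : ι → Fin F → ℂ × ℂ) (μ : ℂ) : Prop :=
  ∀ st, momentTensor w v st = weilTarget F μ st

/-- The quadratic form `⟨v|L|v⟩` of a `2 × 2` matrix `L` (indexed `L row col`). -/
def qform (L : Bool → Bool → ℂ) (p : ℂ × ℂ) : ℂ :=
  ∑ ab : Bool × Bool, L ab.2 ab.1 * (comp p ab.1 * conj (comp p ab.2))

/-- Contraction weight of the functional `X ↦ Π_f tr(Λ_f X_f)` at the entry `st`. -/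
def cwt {F : ℕ} (Λ : Fin F → Bool → Bool → ℂ) (st : Idx F) : ℂ := ∏ f, Λ f (st f).2 (st f).1

/-- `2 × 2` Hermitian. -/
def IsHerm (L : Bool → Bool → ℂ) : Prop := ∀ a b, L a b = conj (L b a)

theorem qform_eq (L : Bool → Bool → ℂ) (p : ℂ × ℂ) :
    qform L p = L false false * (p.1 * conj p.1) + L true true * (p.2 * conj p.2)
      + L true false * (p.1 * conj p.2) + L false true * (p.2 * conj p.1) := by
  simp only [qform, Fintype.sum_prod_type, Fintype.sum_bool, comp_true, comp_false]
  ring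

theorem sum_cwt_mul_projEntry {F : ℕ} (Λ : Fin F → Bool → Bool → ℂ) (v : Fin F → ℂ × ℂ) :
    ∑ st, cwt Λ st * projEntry v st = ∏ f, qform (Λ f) (v f) := by
  have h1 : ∀ st : Idx F, cwt Λ st * projEntry v st
      = ∏ f, (Λ f (st f).2 (st f).1 * (comp (v f) (st f).1 * conj (comp (v f) (st f).2))) := by
    intro st
    rw [cwt, projEntry, ← Finset.prod_mul_distrib]
  simp_rw [h1]
  rw [show (∑ st : Idx F, ∏ f, (Λ f (st f).2 (st f).1 * (comp (v f) (st f).1 * conj (comp (v f) (st f).2))))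
      = ∏ f, ∑ ab : Bool × Bool, (Λ f ab.2 ab.1 * (comp (v f) ab.1 * conj (comp (v f) ab.2))) from
    (Fintype.prod_sum (fun f (ab : Bool × Bool) => Λ f ab.2 ab.1 * (comp (v f) ab.1 * conj (comp (v f) ab.2)))).symm]
  rfl

theorem sum_cwt_mul_weilTarget {F : ℕ} (Λ : Fin F → Bool → Bool → ℂ) (μ : ℂ) :
    ∑ st, cwt Λ st * weilTarget F μ st
      = μ * ∏ f, Λ f true false + conj μ * ∏ f, Λ f false true := by
  simp only [weilTarget, mul_add, Finset.sum_add_distrib, mul_ite, mul_zero, Finset.sum_ite_eq', Finset.mem_univ,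
    if_true]
  simp only [cwt]
  ring

/-- THE PAIRING IDENTITY (g10): `Σ_j w_j Π_f ⟨v_{jf}|Λ_f|v_{jf}⟩ = μ Z + conj (μ Z)`, `Z = Π_f (Λ_f)₁₀`. -/
theorem pairing_identity {F : ℕ} {ι : Type*} [Fintype ι] {w : ι → ℝ} {v : ι → Fin F → ℂ × ℂ} {μ : ℂ}
    (h : CleanWithCharge w v μ) (Λ : Fin F → Bool → Bool → ℂ) (hΛ : ∀ f, IsHerm (Λ f)) :
    ∑ j, (w j : ℂ) * ∏ f, qform (Λ f) (v j f)
      = μ * ∏ f, Λ f true false + conj (μ * ∏ f, Λ f true false) := by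
  have key : ∑ st, cwt Λ st * momentTensor w v st = ∑ st, cwt Λ st * weilTarget F μ st :=
    Finset.sum_congr rfl fun st _ => by rw [h st]
  rw [sum_cwt_mul_weilTarget] at key
  have lhs : ∑ st, cwt Λ st * momentTensor w v st = ∑ j, (w j : ℂ) * ∏ f, qform (Λ f) (v j f) := by
    simp only [momentTensor, Finset.mul_sum]
    rw [Finset.sum_comm]
    refine Finset.sum_congr rfl fun j _ => ?_
    rw [← sum_cwt_mul_projEntry, Finset.mul_sum]
    refine Finset.sum_congr rfl fun st _ => ?_
    ring
  rw [← lhs, key, map_mul, map_prod]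
  congr 2
  exact Finset.prod_congr rfl fun f _ => hΛ f false true

/-- The Hermitian matrix `[[P, conj z], [z, Q]]` (`L true false = z`). -/
def herm (P Q : ℝ) (z : ℂ) : Bool → Bool → ℂ
  | false, false => P
  | false, true => conj z
  | true, false => z
  | true, true => Q

theorem isHerm_herm (P Q : ℝ) (z : ℂ) : IsHerm (herm P Q z) := by
  intro a b
  cases a <;> cases b <;> simp [herm, Complex.conj_ofReal]

@[simp] theorem herm_true_false (P Q : ℝ) (z : ℂ) : herm P Q z true false = z := rfl

theorem qform_herm (P Q : ℝ) (z : ℂ) (p : ℂ × ℂ) :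
    qform (herm P Q z) p
      = ((P * normSq p.1 + Q * normSq p.2 + 2 * (z * (p.1 * conj p.2)).re : ℝ) : ℂ) := by
  rw [qform_eq]
  have hc : conj z * (p.2 * conj p.1) = conj (z * (p.1 * conj p.2)) := by
    simp only [map_mul, Complex.conj_conj]; ring
  simp only [herm]
  rw [hc, Complex.mul_conj, Complex.mul_conj, add_assoc, Complex.add_conj]
  push_cast
  ring

/-! ## Part 1 — PSD functionals: the annihilator `|v^⊥⟩⟨v^⊥|` and the phase probe -/

/-- The PSD annihilator of `p = (p₀, p₁)`: the rank-one projector onto `p^⊥ = (−conj p₁, conj p₀)`, i.e.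
`[[|p₁|², −p₀ conj p₁], [−p₁ conj p₀, |p₀|²]]`; its off-diagonal entry `−p₁ conj p₀` vanishes iff `p` is polar. -/
def kmat (p : ℂ × ℂ) : Bool → Bool → ℂ := herm (normSq p.2) (normSq p.1) (-(p.2 * conj p.1))

/-- The phase probe `[[1, conj ζ], [ζ, 1]]` (PSD when `|ζ| ≤ 1`). -/
def gmat (ζ : ℂ) : Bool → Bool → ℂ := herm 1 1 ζ

theorem isHerm_kmat (p : ℂ × ℂ) : IsHerm (kmat p) := isHerm_herm _ _ _
theorem isHerm_gmat (ζ : ℂ) : IsHerm (gmat ζ) := isHerm_herm _ _ _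
@[simp] theorem kmat_true_false (p : ℂ × ℂ) : kmat p true false = -(p.2 * conj p.1) := rfl
@[simp] theorem gmat_true_false (ζ : ℂ) : gmat ζ true false = ζ := rfl

theorem normSq_sub_mul (p q : ℂ × ℂ) :
    normSq (p.2 * q.1 - p.1 * q.2)
      = normSq p.2 * normSq q.1 + normSq p.1 * normSq q.2 + 2 * (-(p.2 * conj p.1) * (q.1 * conj q.2)).re := by
  simp only [Complex.normSq_apply, Complex.sub_re, Complex.sub_im, Complex.mul_re, Complex.mul_im, Complex.neg_re,
    Complex.neg_im, Complex.conj_re, Complex.conj_im]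
  ring

theorem normSq_phase_add (ζ : ℂ) (q : ℂ × ℂ) :
    normSq (ζ * q.1 + q.2) = normSq ζ * normSq q.1 + normSq q.2 + 2 * (ζ * (q.1 * conj q.2)).re := by
  simp only [Complex.normSq_apply, Complex.add_re, Complex.add_im, Complex.mul_re, Complex.mul_im,
    Complex.conj_re, Complex.conj_im]
  ring

/-- `⟨q| kmat p |q⟩ = |p₁ q₀ − p₀ q₁|²` — real, non-negative, zero at `q = p`. -/
theorem qform_kmat (p q : ℂ × ℂ) : qform (kmat p) q = ((normSq (p.2 * q.1 - p.1 * q.2) : ℝ) : ℂ) := by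
  rw [kmat, qform_herm, normSq_sub_mul]

theorem qform_kmat_self (p : ℂ × ℂ) : qform (kmat p) p = 0 := by
  rw [qform_kmat, Complex.ofReal_eq_zero, show p.2 * p.1 - p.1 * p.2 = 0 by ring, map_zero]

/-- `⟨q| gmat ζ |q⟩ = |ζ q₀ + q₁|²` for `|ζ| = 1`. -/
theorem qform_gmat (ζ : ℂ) (hζ : normSq ζ = 1) (q : ℂ × ℂ) :
    qform (gmat ζ) q = ((normSq (ζ * q.1 + q.2) : ℝ) : ℂ) := by
  rw [gmat, qform_herm, normSq_phase_add, hζ]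
  push_cast
  ring

/-! ## Part 2 — the signed octagon bound (`F = 4`, at most three positive terms, non-polar vectors) -/

/-- Pairing a clean configuration with a Hermitian family whose quadratic forms are (real and) non-negative on every
term and VANISH somewhere on every positive-weight term gives `Re(μ · Z) ≤ 0`, `Z = Π_f (Λ_f)₁₀`. -/
theorem re_nonpos_of_psd_kill {F : ℕ} {ι : Type*} [Fintype ι] {w : ι → ℝ} {v : ι → Fin F → ℂ × ℂ} {μ : ℂ}
    (h : CleanWithCharge w v μ) (Λ : Fin F → Bool → Bool → ℂ) (hΛ : ∀ f, IsHerm (Λ f))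
    (r : ι → Fin F → ℝ) (hr : ∀ j f, qform (Λ f) (v j f) = (r j f : ℂ)) (hr0 : ∀ j f, 0 ≤ r j f)
    (hkill : ∀ j, 0 < w j → ∃ f, r j f = 0) :
    (μ * ∏ f, Λ f true false).re ≤ 0 := by
  have e := pairing_identity h Λ hΛ
  have lhs : ∑ j, (w j : ℂ) * ∏ f, qform (Λ f) (v j f) = ((∑ j, w j * ∏ f, r j f : ℝ) : ℂ) := by
    push_cast
    refine Finset.sum_congr rfl fun j _ => ?_
    congr 1
    exact Finset.prod_congr rfl fun f _ => hr j f
  rw [lhs] at e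
  have hterm : ∀ j, w j * ∏ f, r j f ≤ 0 := by
    intro j
    by_cases hw : 0 < w j
    · obtain ⟨f, hf⟩ := hkill j hw
      rw [Finset.prod_eq_zero (Finset.mem_univ f) hf, mul_zero]
    · exact mul_nonpos_of_nonpos_of_nonneg (not_lt.mp hw) (Finset.prod_nonneg fun f _ => hr0 j f)
  have hsum : ∑ j, w j * ∏ f, r j f ≤ 0 := Finset.sum_nonpos fun j _ => hterm j
  have hre := congrArg Complex.re e
  simp only [Complex.ofReal_re, Complex.add_re, Complex.conj_re] at hre
  linarith

/-- A complex number `u` with `Re(u ζ) ≤ 0` for the four phases `ζ = 1, i, −1, −i` is zero. -/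
theorem eq_zero_of_re_mul_phases_nonpos (u : ℂ) (h1 : (u * 1).re ≤ 0) (h2 : (u * I).re ≤ 0)
    (h3 : (u * (-1)).re ≤ 0) (h4 : (u * (-I)).re ≤ 0) : u = 0 := by
  simp only [mul_one, Complex.mul_re, Complex.I_re, Complex.I_im, mul_zero, zero_sub, Complex.neg_re,
    mul_neg] at h1 h2 h3 h4
  apply Complex.ext <;> simp <;> linarith

/-- **SIGNED OCTAGON BOUND** (`F = 4`, pole-free).  Weighted product projectors on `(ℂ²)^{⊗4}`, clean with Weil charge `μ`,
all vectors non-polar, at most THREE terms of positive weight (the others `≤ 0`, in any number): then `μ = 0`.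
(Sharp: the octagon has four positive terms — `octagon_sharp` of g10, `lineTen_sharp` below.) -/
theorem weilCharge_eq_zero_of_few_positive {ι : Type*} [Fintype ι] (w : ι → ℝ) (v : ι → Fin 4 → ℂ × ℂ) (μ : ℂ)
    (h : CleanWithCharge w v μ) (hnp : ∀ j f, (v j f).1 ≠ 0 ∧ (v j f).2 ≠ 0)
    (hpos : (univ.filter fun j => 0 < w j).card ≤ 3) : μ = 0 := by
  classical
  -- inject the positive terms into the three slots `{0, 1, 2}`; slot `3` stays free for the phase probe
  let Pos := {j : ι // 0 < w j}
  have hcardPos : Fintype.card Pos ≤ 3 := by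
    rw [Fintype.card_subtype]; exact hpos
  obtain ⟨e, he⟩ : ∃ e : Pos ↪ Fin 4, Set.range e ⊆ ((univ.erase (3 : Fin 4) : Finset (Fin 4)) : Set _) := by
    apply Function.Embedding.exists_of_card_le_finset
    rw [Finset.card_erase_of_mem (Finset.mem_univ _), Finset.card_univ, Fintype.card_fin]
    omega
  have he3 : ∀ j : Pos, e j ≠ 3 := fun j => by
    have hm : e j ∈ (univ.erase (3 : Fin 4) : Finset (Fin 4)) := Finset.mem_coe.mp (he ⟨j, rfl⟩)
    exact (Finset.mem_erase.mp hm).1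
  -- the family: annihilator of the positive term sitting in slot `f`, phase probe `ζ` in slot 3, probe `1` elsewhere
  let Λ : ℂ → Fin 4 → Bool → Bool → ℂ := fun ζ f =>
    if hf : ∃ j : Pos, e j = f then kmat (v hf.choose.1 f) else if f = 3 then gmat ζ else gmat 1
  have hΛherm : ∀ ζ f, IsHerm (Λ ζ f) := by
    intro ζ f
    simp only [Λ]
    split_ifs
    · exact isHerm_kmat _
    · exact isHerm_gmat _
    · exact isHerm_gmat _
  -- the real values of the quadratic forms
  let r : ℂ → ι → Fin 4 → ℝ := fun ζ j f =>
    if hf : ∃ j : Pos, e j = f then normSq ((v hf.choose.1 f).2 * (v j f).1 - (v hf.choose.1 f).1 * (v j f).2)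
    else if f = 3 then normSq (ζ * (v j f).1 + (v j f).2) else normSq (1 * (v j f).1 + (v j f).2)
  have hr : ∀ ζ, normSq ζ = 1 → ∀ j f, qform (Λ ζ f) (v j f) = (r ζ j f : ℂ) := by
    intro ζ hζ j f
    simp only [Λ, r]
    split_ifs with hf h3
    · exact qform_kmat _ _
    · exact qform_gmat ζ hζ _
    · exact qform_gmat 1 (by simp) _
  have hr0 : ∀ ζ j f, 0 ≤ r ζ j f := by
    intro ζ j f
    simp only [r]
    split_ifs <;> exact normSq_nonneg _
  have hkill : ∀ ζ j, 0 < w j → ∃ f, r ζ j f = 0 := by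
    intro ζ j hj
    refine ⟨e ⟨j, hj⟩, ?_⟩
    have hf : ∃ j' : Pos, e j' = e ⟨j, hj⟩ := ⟨⟨j, hj⟩, rfl⟩
    simp only [r, dif_pos hf]
    have hch : hf.choose = ⟨j, hj⟩ := e.injective hf.choose_spec
    rw [hch, show (v j (e ⟨j, hj⟩)).2 * (v j (e ⟨j, hj⟩)).1 - (v j (e ⟨j, hj⟩)).1 * (v j (e ⟨j, hj⟩)).2 = 0 by ring,
      map_zero]
  -- the off-diagonal product: `Z(ζ) = Z₀ · ζ` with `Z₀ ≠ 0`
  let Z₀ : ℂ := ∏ f ∈ univ.erase (3 : Fin 4), Λ 1 f true false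
  have hΛ3 : ∀ ζ, Λ ζ 3 true false = ζ := by
    intro ζ
    have hn : ¬ ∃ j : Pos, e j = 3 := fun ⟨j, hj⟩ => he3 j hj
    show (if hf : ∃ j : Pos, e j = 3 then kmat (v hf.choose.1 3) else if (3 : Fin 4) = 3 then gmat ζ else gmat 1)
      true false = ζ
    rw [dif_neg hn, if_pos rfl]
    rfl
  have hΛne3 : ∀ ζ f, f ≠ 3 → Λ ζ f = Λ 1 f := by
    intro ζ f hf
    show (if hf : ∃ j : Pos, e j = f then kmat (v hf.choose.1 f) else if f = 3 then gmat ζ else gmat 1)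
      = (if hf : ∃ j : Pos, e j = f then kmat (v hf.choose.1 f) else if f = 3 then gmat 1 else gmat 1)
    rw [if_neg hf, if_neg hf]
  have hZ : ∀ ζ, ∏ f, Λ ζ f true false = Z₀ * ζ := by
    intro ζ
    rw [← Finset.prod_erase_mul _ _ (Finset.mem_univ (3 : Fin 4)), hΛ3]
    have hπ : ∏ f ∈ univ.erase (3 : Fin 4), Λ ζ f true false = Z₀ :=
      Finset.prod_congr rfl fun f hf => by rw [hΛne3 ζ f (Finset.mem_erase.mp hf).1]
    rw [hπ]
  have hZ₀ : Z₀ ≠ 0 := by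
    refine Finset.prod_ne_zero_iff.mpr fun f hf => ?_
    have hf3 : f ≠ 3 := (Finset.mem_erase.mp hf).1
    simp only [Λ, if_neg hf3]
    split_ifs with hj
    · rw [kmat_true_false, neg_ne_zero]
      exact mul_ne_zero (hnp _ _).2 ((map_ne_zero_iff _ (RingHom.injective _)).mpr (hnp _ _).1)
    · rw [gmat_true_false]; exact one_ne_zero
  -- four phases
  have key : ∀ ζ, normSq ζ = 1 → (μ * Z₀ * ζ).re ≤ 0 := by
    intro ζ hζ
    have := re_nonpos_of_psd_kill h (Λ ζ) (hΛherm ζ) (r ζ) (hr ζ hζ) (hr0 ζ) (hkill ζ)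
    rwa [hZ ζ, ← mul_assoc] at this
  have hu : μ * Z₀ = 0 :=
    eq_zero_of_re_mul_phases_nonpos (μ * Z₀) (key 1 (by simp)) (key I (by simp))
      (key (-1) (by simp)) (key (-I) (by simp))
  rcases mul_eq_zero.mp hu with hμ | hZ'
  · exact hμ
  · exact absurd hZ' hZ₀

/-- **HUB LAW, algebraic half** (memo §3, read with `ι` = the order-4 terms of a reduced one-apex two-term UP room of rank
`r ≤ 4`: the positive terms are the `≤ r − 1` residual hub-free cells left after avoiding one hub cell). -/
theorem hubLaw_charge_zero_of_rank_le_four {ι : Type*} [Fintype ι] (r : ℕ) (hr : r ≤ 4)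
    (w : ι → ℝ) (v : ι → Fin 4 → ℂ × ℂ) (μ : ℂ) (h : CleanWithCharge w v μ)
    (hnp : ∀ j f, (v j f).1 ≠ 0 ∧ (v j f).2 ≠ 0) (hpos : (univ.filter fun j => 0 < w j).card + 1 ≤ r) : μ = 0 :=
  weilCharge_eq_zero_of_few_positive w v μ h hnp (by omega)

/-! ## Part 3 — the two-orbit mechanism and the LINE-10 rank-5 witness on the `ℚ(i)` frame -/

theorem projEntry_const {F : ℕ} (z : ℂ) (st : Idx F) :
    projEntry (fun _ => ((1 : ℂ), z)) st
      = z ^ (univ.filter fun f => (st f).1 = true).card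
        * conj z ^ (univ.filter fun f => (st f).2 = true).card := by
  unfold projEntry
  have h2 : ∀ b : Bool, conj (comp ((1 : ℂ), z) b) = if b = true then conj z else 1 := by
    intro b; cases b <;> simp
  have h1 : ∀ b : Bool, comp ((1 : ℂ), z) b = if b = true then z else 1 := by
    intro b; cases b <;> simp
  simp_rw [h2, h1]
  rw [Finset.prod_mul_distrib, Finset.prod_ite, Finset.prod_const, Finset.prod_const_one, mul_one,
    Finset.prod_ite, Finset.prod_const, Finset.prod_const_one, mul_one]

theorem card_filter_univ_eq_zero_iff {α : Type*} [Fintype α] (p : α → Prop) [DecidablePred p] :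
    (univ.filter p).card = 0 ↔ ∀ x, ¬ p x := by
  simp [Finset.card_eq_zero, Finset.filter_eq_empty_iff]

theorem card_filter_univ_eq_card_iff {α : Type*} [Fintype α] (p : α → Prop) [DecidablePred p] :
    (univ.filter p).card = Fintype.card α ↔ ∀ x, p x := by
  constructor
  · intro h x
    have hsub : univ.filter p = univ :=
      Finset.eq_of_subset_of_card_le (Finset.filter_subset _ _) (by rw [h, Finset.card_univ])
    have hx : x ∈ univ.filter p := by rw [hsub]; exact Finset.mem_univ x
    exact (Finset.mem_filter.mp hx).2
  · intro h
    rw [Finset.filter_true_of_mem (fun x _ => h x), Finset.card_univ]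

theorem card_filter_fin4_eq_four_iff (p : Fin 4 → Prop) [DecidablePred p] :
    (univ.filter p).card = 4 ↔ ∀ x, p x := by
  have h := card_filter_univ_eq_card_iff p
  simp only [Fintype.card_fin] at h
  exact h

theorem const_ft_iff (st : Idx 4) :
    ((∀ f, ¬ (st f).1 = true) ∧ (∀ f, (st f).2 = true)) ↔ st = fun _ => (false, true) := by
  constructor
  · rintro ⟨h1, h2⟩; funext f
    exact Prod.ext (by simpa using h1 f) (h2 f)
  · rintro rfl; simp

theorem const_tf_iff (st : Idx 4) :
    ((∀ f, (st f).1 = true) ∧ (∀ f, ¬ (st f).2 = true)) ↔ st = fun _ => (true, false) := by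
  constructor
  · rintro ⟨h1, h2⟩; funext f
    exact Prod.ext (h1 f) (by simpa using h2 f)
  · rintro rfl; simp

/-- A diagonal design (every term `j` uses the same vector `(1, z_j)` in all four factors) whose power sums
`S a b = Σ_j w_j z_j^a conj(z_j)^b` (`a, b ≤ 4`) vanish except `S 0 4 = μ`, `S 4 0 = conj μ` is clean with charge `μ`. -/
theorem clean_of_powerSums {ι : Type*} [Fintype ι] (w : ι → ℝ) (z : ι → ℂ) (μ : ℂ)
    (hS : ∀ a b : ℕ, a ≤ 4 → b ≤ 4 →
      ∑ j, (w j : ℂ) * (z j ^ a * conj (z j) ^ b)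
        = if a = 0 ∧ b = 4 then μ else if a = 4 ∧ b = 0 then conj μ else 0) :
    CleanWithCharge w (fun j (_ : Fin 4) => ((1 : ℂ), z j)) μ := by
  intro st
  have hmain : momentTensor w (fun j (_ : Fin 4) => ((1 : ℂ), z j)) st
      = ∑ j, (w j : ℂ) * (z j ^ (univ.filter fun f => (st f).1 = true).card
          * conj (z j) ^ (univ.filter fun f => (st f).2 = true).card) := by
    unfold momentTensor
    refine Finset.sum_congr rfl fun j _ => ?_
    rw [projEntry_const]
  have ha : (univ.filter fun f => (st f).1 = true).card ≤ 4 :=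
    (Finset.card_filter_le _ _).trans_eq (by simp)
  have hb : (univ.filter fun f => (st f).2 = true).card ≤ 4 :=
    (Finset.card_filter_le _ _).trans_eq (by simp)
  rw [hmain, hS _ _ ha hb]
  have e1 : ((univ.filter fun f => (st f).1 = true).card = 0 ∧
      (univ.filter fun f => (st f).2 = true).card = 4) ↔ st = fun _ => (false, true) := by
    rw [card_filter_univ_eq_zero_iff, card_filter_fin4_eq_four_iff]; exact const_ft_iff st
  have e2 : ((univ.filter fun f => (st f).1 = true).card = 4 ∧
      (univ.filter fun f => (st f).2 = true).card = 0) ↔ st = fun _ => (true, false) := by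
    rw [card_filter_fin4_eq_four_iff, card_filter_univ_eq_zero_iff]; exact const_tf_iff st
  unfold weilTarget
  by_cases h1 : st = fun _ => (false, true)
  · have h2 : ¬ st = fun _ => (true, false) := by
      intro h; have := congrFun (h1.symm.trans h) 0; simp at this
    rw [if_pos (e1.mpr h1), if_pos h1, if_neg h2, add_zero]
  · rw [if_neg (mt e1.mp h1), if_neg h1, zero_add]
    by_cases h2 : st = fun _ => (true, false)
    · rw [if_pos (e2.mpr h2), if_pos h2]
    · rw [if_neg (mt e2.mp h2), if_neg h2]

/-- The LINE-10 equatorial design of the `ℚ(i)` frame, written with the Gaussian integers `β`, `|β| = 5` (the memo's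
unit-circle normalisation `z = β/5` rescales every power sum `S a b` by `5^{-(a+b)}`, so the zero pattern is the same):
`j < 4`: the Pythagorean `μ₄`-orbit `i^m (3 + 4i)` (the four N-cells), `4 ≤ j`: the unit orbit `5 i^m` (the four P-cells,
letters `(5, 5ū)`, 5-divisible). -/
noncomputable def tenZ : Fin 8 → ℂ :=
  ![⟨3, 4⟩, ⟨-4, 3⟩, ⟨-3, -4⟩, ⟨4, -3⟩, ⟨5, 0⟩, ⟨0, 5⟩, ⟨-5, 0⟩, ⟨0, -5⟩]

/-- Design weights: `+1` on the Pythagorean orbit (N), `−1` on the unit orbit (P). -/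
noncomputable def tenW : Fin 8 → ℝ := ![1, 1, 1, 1, -1, -1, -1, -1]

/-- The diagonal rays `v_{j,f} = (1, z_j)`. -/
noncomputable def tenV (j : Fin 8) (_f : Fin 4) : ℂ × ℂ := (1, tenZ j)

/-- The Weil charge of the LINE-10 design in the Gaussian-integer normalisation: `μ₁₀ = Σ_j w_j conj(β_j)⁴ = −4608 + 1344 i`
(`= 625 ×` the unit-circle value `(−4608 + 1344 i)/625` of the memo). -/
noncomputable def muTen : ℂ := ⟨-4608, 1344⟩

/-- The power sums `S a b = Σ_j w_j z_j^a conj(z_j)^b` of the LINE-10 design. -/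
noncomputable def tenS (a b : ℕ) : ℂ := ∑ j, (tenW j : ℂ) * (tenZ j ^ a * conj (tenZ j) ^ b)

set_option maxHeartbeats 1600000 in
/-- All power sums with `a, b ≤ 4` vanish except the two Weil modes `(0,4) ↦ μ₁₀`, `(4,0) ↦ conj μ₁₀`: this is the list
of `(D1)–(D4)` moment identities of the design (orders 1–3 clean with `κ = 0`, order 4 = the Weil target), the hub
letters contributing nothing but rank. -/
theorem tenS_eq (a b : ℕ) (ha : a ≤ 4) (hb : b ≤ 4) :
    tenS a b = if a = 0 ∧ b = 4 then muTen else if a = 4 ∧ b = 0 then conj muTen else 0 := by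
  interval_cases a <;> interval_cases b <;>
    (simp [tenS, Fin.sum_univ_eight, tenZ, tenW, muTen, Complex.ext_iff, pow_succ, Complex.mul_re, Complex.mul_im] <;>
      norm_num)

/-- All eight rays lie on one latitude circle (`|β|² = 25`, the equator `d = 0` of the record frame), as the ONSET THEOREM
of g9 requires of any charged order-4 measure. -/
theorem lineTen_on_equator (j : Fin 8) : normSq (tenZ j) = 25 := by
  fin_cases j <;> simp [tenZ, Complex.normSq_apply] <;> norm_num

/-- **RANK-5 WITNESS, `ℚ(i)` frame, LINE 10.**  The two-orbit equatorial design is clean with charge `μ₁₀`. -/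
theorem lineTen_sharp : CleanWithCharge tenW tenV muTen :=
  clean_of_powerSums tenW tenZ muTen fun a b ha hb => by rw [← tenS_eq a b ha hb]; rfl

/-- `μ₁₀ ≠ 0`: the design carries a genuine Weil charge. -/
theorem lineTen_charge_ne_zero : muTen ≠ 0 := by
  intro h
  have := congrArg Complex.re h
  norm_num [muTen] at this

/-- The design has exactly FOUR positive terms — one more than `weilCharge_eq_zero_of_few_positive` allows: with the five
hub letters of memo §4 (weight `+5` at order 0, invisible at orders `≥ 1`) it is the moment certificate of a rank-5 room,
so the bound «rank ≥ 5» of the HUB LAW is attained on the record frame. -/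
theorem tenW_pos_iff (j : Fin 8) : 0 < tenW j ↔ (j : ℕ) < 4 := by
  fin_cases j <;> norm_num [tenW]

/-! ## Part 4 — the SQUARE THEOREM (rank 5 below the first multiple lives on two concyclic squares)

Memo §4: below the first multiple on its latitude circle, the order-4 measure of a rank-5 torsion-free one-apex UP room
with `μ ≠ 0` is `V · (1_U − 1_W)` for two 4-sets `U = {a,b,c,d}`, `W = {a',b',c',d'}` of unit complex numbers (ray
directions) with equal power sums `p₁, p₂, p₃` (modes 1–3 clean).  THEOREM: then both are SQUARES (`μ₄`-orbits:
all fourth powers equal) and the Weil mode `p₄(U) − p₄(W) = 4 (e₄(W) − e₄(U))` is automatically non-zero.  In a CM frame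
`E_K × E_K` a square of rays `β, iβ, … ∈ O_K` forces `i ∈ K`: the witness frame `ℚ(i)` of 18881 is the ONLY imaginary
quadratic field with rank-5 rooms in that regime (memo §5; exact search `rank5_fields.py` agrees on 29 circles of 7 fields). -/

/-- Newton/Vieta bookkeeping: equal `p₁, p₂, p₃` give equal `e₂`. -/
theorem e2_eq_of_powerSums (a b c d a' b' c' d' : ℂ)
    (h1 : a + b + c + d = a' + b' + c' + d')
    (h2 : a ^ 2 + b ^ 2 + c ^ 2 + d ^ 2 = a' ^ 2 + b' ^ 2 + c' ^ 2 + d' ^ 2) :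
    a*b + a*c + a*d + b*c + b*d + c*d = a'*b' + a'*c' + a'*d' + b'*c' + b'*d' + c'*d' := by
  linear_combination (1/2 : ℂ) * (a + b + c + d + a' + b' + c' + d') * h1 - (1/2 : ℂ) * h2

/-- Equal `p₁, p₂, p₃` give equal `e₃`. -/
theorem e3_eq_of_powerSums (a b c d a' b' c' d' : ℂ)
    (h1 : a + b + c + d = a' + b' + c' + d')
    (h2 : a ^ 2 + b ^ 2 + c ^ 2 + d ^ 2 = a' ^ 2 + b' ^ 2 + c' ^ 2 + d' ^ 2)
    (h3 : a ^ 3 + b ^ 3 + c ^ 3 + d ^ 3 = a' ^ 3 + b' ^ 3 + c' ^ 3 + d' ^ 3) :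
    a*b*c + a*b*d + a*c*d + b*c*d = a'*b'*c' + a'*b'*d' + a'*c'*d' + b'*c'*d' := by
  have hE2 := e2_eq_of_powerSums a b c d a' b' c' d' h1 h2
  linear_combination (1/3 : ℂ) * h3 - (1/3 : ℂ) * (a' + b' + c' + d') * h2
    - (1/3 : ℂ) * (a ^ 2 + b ^ 2 + c ^ 2 + d ^ 2) * h1
    + (1/3 : ℂ) * (a'*b' + a'*c' + a'*d' + b'*c' + b'*d' + c'*d') * h1
    + (1/3 : ℂ) * (a + b + c + d) * hE2

/-- Self-inversive relations of a monic quartic with unimodular roots: `e₃ = e₄ · conj e₁`. -/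
theorem e3_eq_e4_mul_conj_e1 (a b c d : ℂ) (ha : a * conj a = 1) (hb : b * conj b = 1) (hc : c * conj c = 1)
    (hd : d * conj d = 1) :
    a*b*c + a*b*d + a*c*d + b*c*d = a*b*c*d * (conj a + conj b + conj c + conj d) := by
  linear_combination (-(b*c*d)) * ha - (a*c*d) * hb - (a*b*d) * hc - (a*b*c) * hd

/-- … and `e₂ = e₄ · conj e₂`. -/
theorem e2_eq_e4_mul_conj_e2 (a b c d : ℂ) (ha : a * conj a = 1) (hb : b * conj b = 1) (hc : c * conj c = 1)
    (hd : d * conj d = 1) :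
    a*b + a*c + a*d + b*c + b*d + c*d
      = a*b*c*d * (conj a * conj b + conj a * conj c + conj a * conj d + conj b * conj c + conj b * conj d
          + conj c * conj d) := by
  linear_combination (-(c*d*b*conj b)) * ha - (c*d) * hb - (b*d*c*conj c) * ha - (b*d) * hc
    - (b*c*d*conj d) * ha - (b*c) * hd - (a*d*c*conj c) * hb - (a*d) * hc - (a*c*d*conj d) * hb - (a*c) * hd
    - (a*b*d*conj d) * hc - (a*b) * hd

/-- **SQUARE THEOREM.**  Two 4-sets of unit complex numbers with the same power sums `p₁, p₂, p₃` and different products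
are both squares (all fourth powers equal, `= −e₄`), and their fourth power sums differ by `4 (e₄' − e₄) ≠ 0`. -/
theorem square_theorem (a b c d a' b' c' d' : ℂ)
    (ha : a * conj a = 1) (hb : b * conj b = 1) (hc : c * conj c = 1) (hd : d * conj d = 1)
    (ha' : a' * conj a' = 1) (hb' : b' * conj b' = 1) (hc' : c' * conj c' = 1) (hd' : d' * conj d' = 1)
    (h1 : a + b + c + d = a' + b' + c' + d')
    (h2 : a ^ 2 + b ^ 2 + c ^ 2 + d ^ 2 = a' ^ 2 + b' ^ 2 + c' ^ 2 + d' ^ 2)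
    (h3 : a ^ 3 + b ^ 3 + c ^ 3 + d ^ 3 = a' ^ 3 + b' ^ 3 + c' ^ 3 + d' ^ 3)
    (h4 : a * b * c * d ≠ a' * b' * c' * d') :
    (a ^ 4 = -(a*b*c*d) ∧ b ^ 4 = -(a*b*c*d) ∧ c ^ 4 = -(a*b*c*d) ∧ d ^ 4 = -(a*b*c*d)) ∧
    (a' ^ 4 = -(a'*b'*c'*d') ∧ b' ^ 4 = -(a'*b'*c'*d') ∧ c' ^ 4 = -(a'*b'*c'*d') ∧ d' ^ 4 = -(a'*b'*c'*d')) ∧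
    (a ^ 4 + b ^ 4 + c ^ 4 + d ^ 4) - (a' ^ 4 + b' ^ 4 + c' ^ 4 + d' ^ 4) = 4 * (a'*b'*c'*d' - a*b*c*d) := by
  have hE2 := e2_eq_of_powerSums a b c d a' b' c' d' h1 h2
  have hE3 := e3_eq_of_powerSums a b c d a' b' c' d' h1 h2 h3
  have hS3 := e3_eq_e4_mul_conj_e1 a b c d ha hb hc hd
  have hS3' := e3_eq_e4_mul_conj_e1 a' b' c' d' ha' hb' hc' hd'
  have hS2 := e2_eq_e4_mul_conj_e2 a b c d ha hb hc hd
  have hS2' := e2_eq_e4_mul_conj_e2 a' b' c' d' ha' hb' hc' hd'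
  have hc1 : conj a' + conj b' + conj c' + conj d' = conj a + conj b + conj c + conj d := by
    have := congrArg conj h1; simp only [map_add] at this; exact this.symm
  have hc2 : conj a' * conj b' + conj a' * conj c' + conj a' * conj d' + conj b' * conj c' + conj b' * conj d'
        + conj c' * conj d'
      = conj a * conj b + conj a * conj c + conj a * conj d + conj b * conj c + conj b * conj d + conj c * conj d := by
    have := congrArg conj hE2; simp only [map_add, map_mul] at this; exact this.symm
  have hne : a*b*c*d - a'*b'*c'*d' ≠ 0 := sub_ne_zero.mpr h4
  -- `e₁ = 0`
  have k1 : (a*b*c*d - a'*b'*c'*d') * (conj a + conj b + conj c + conj d) = 0 := by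
    linear_combination (-1 : ℂ) * hS3 + hS3' + hE3 + (a'*b'*c'*d') * hc1
  have hC1 : conj a + conj b + conj c + conj d = 0 := (mul_eq_zero.mp k1).resolve_left hne
  have hE1z : a + b + c + d = 0 := by
    have := congrArg conj hC1; simp only [map_add, Complex.conj_conj, map_zero] at this; exact this
  -- `e₂ = 0`
  have k2 : (a*b*c*d - a'*b'*c'*d') * (conj a * conj b + conj a * conj c + conj a * conj d + conj b * conj c
      + conj b * conj d + conj c * conj d) = 0 := by
    linear_combination (-1 : ℂ) * hS2 + hS2' + hE2 + (a'*b'*c'*d') * hc2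
  have hC2 : conj a * conj b + conj a * conj c + conj a * conj d + conj b * conj c + conj b * conj d
      + conj c * conj d = 0 := (mul_eq_zero.mp k2).resolve_left hne
  have hE2z : a*b + a*c + a*d + b*c + b*d + c*d = 0 := by
    have := congrArg conj hC2; simp only [map_add, map_mul, Complex.conj_conj, map_zero] at this; exact this
  -- `e₃ = 0`
  have hE3z : a*b*c + a*b*d + a*c*d + b*c*d = 0 := by rw [hS3, hC1, mul_zero]
  -- the primed side
  have hE1z' : a' + b' + c' + d' = 0 := by rw [← h1, hE1z]
  have hE2z' : a'*b' + a'*c' + a'*d' + b'*c' + b'*d' + c'*d' = 0 := by rw [← hE2, hE2z]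
  have hE3z' : a'*b'*c' + a'*b'*d' + a'*c'*d' + b'*c'*d' = 0 := by rw [← hE3, hE3z]
  -- each root satisfies `u⁴ = −e₄` (expand `Π_k (u − u_k) = 0`)
  have qa : a ^ 4 = -(a*b*c*d) := by linear_combination (a ^ 3) * hE1z - (a ^ 2) * hE2z + a * hE3z
  have qb : b ^ 4 = -(a*b*c*d) := by linear_combination (b ^ 3) * hE1z - (b ^ 2) * hE2z + b * hE3z
  have qc : c ^ 4 = -(a*b*c*d) := by linear_combination (c ^ 3) * hE1z - (c ^ 2) * hE2z + c * hE3z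
  have qd : d ^ 4 = -(a*b*c*d) := by linear_combination (d ^ 3) * hE1z - (d ^ 2) * hE2z + d * hE3z
  have qa' : a' ^ 4 = -(a'*b'*c'*d') := by linear_combination (a' ^ 3) * hE1z' - (a' ^ 2) * hE2z' + a' * hE3z'
  have qb' : b' ^ 4 = -(a'*b'*c'*d') := by linear_combination (b' ^ 3) * hE1z' - (b' ^ 2) * hE2z' + b' * hE3z'
  have qc' : c' ^ 4 = -(a'*b'*c'*d') := by linear_combination (c' ^ 3) * hE1z' - (c' ^ 2) * hE2z' + c' * hE3z'
  have qd' : d' ^ 4 = -(a'*b'*c'*d') := by linear_combination (d' ^ 3) * hE1z' - (d' ^ 2) * hE2z' + d' * hE3z'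
  refine ⟨⟨qa, qb, qc, qd⟩, ⟨qa', qb', qc', qd'⟩, ?_⟩
  linear_combination qa + qb + qc + qd - qa' - qb' - qc' - qd'

/-- FIELD COROLLARY (the arithmetic punch line, in its simplest form): if a non-zero complex number `β` and `i·β` both
lie in the image of `ℤ[ω]`-type coordinates… — we only record the elementary fact used in memo §5: a square of rays needs
the rotation `i`; concretely, if `β ≠ 0` and `i β = q β` for a scalar `q` then `q = i`.  (That `i ∉ ℚ(√−D)` for
`D ≠ 1` is where the memo's «only `ℚ(i)`» comes from.) -/
theorem rotation_scalar_is_I (β q : ℂ) (hβ : β ≠ 0) (h : I * β = q * β) : q = I :=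
  (mul_right_cancel₀ hβ h).symm

end Summit.HodgeConjecture.HodgeConjecture.Cruxes.BlochSeedDiscOne.HubLaw
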